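import Mathlib
import Literature.Analysis.FluidPDE.TaoLocalisation
import Summits.NavierStokesRegularity.NavierStokesRegularity.Theorems.SlicedKelvinFluxZoomStubNearFieldFlux
import Summits.NavierStokesRegularity.NavierStokesRegularity.Theorems.SlicedKelvinFluxZoomStubUnitScaleVelocity
import Summits.NavierStokesRegularity.NavierStokesRegularity.Theorems.SlicedKelvinFluxZoomStubFluxVelocity
import HarnessLib

/-!
# `SlicedKelvin.FluxVelocityBound` — velocity from vorticity maximum × planar flux
  (item stmt-NavierStokesRegularity-15604)

**Statement.** There is an absolute `C` such that every smooth, rapidly decaying, divergence-free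
`u` on `ℝ³` with `‖curl u‖_∞ ≤ W` and unsigned flux of `curl u` at most `Φ` through every plane
satisfies `‖u(x)‖² ≤ C·W·Φ` for all `x`; here `C = 12/π`.

PROOF. Composition of three LANDED stubs of the registered line of the crux `SlicedKelvin.FluxZoom`
(namespace `Theorems.FluxZoom.Registered`): `stub_nearFieldFlux` (the near-field Biot–Savart
integral at bounded planar flux, unconditional) feeds `stub_unitScaleVelocity` (unit-scale bound
`‖v(x)‖ ≤ rW + 3Φ/(πr) + C_v‖v‖₂`), which feeds `stub_fluxVelocity` (scaling out the energy:
`‖v(x)‖² ≤ (12/π) W Φ` for `C²` divergence-free `v ∈ L²`). A rapidly decaying smooth field is `C²`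
and in `L²` (`HasRapidSpatialDecay.lintegral_enorm_iteratedFDeriv_sq_lt_top` at order `0`).

HONEST FRAMING: a kinematic Biot–Savart estimate; nothing here bears on the regularity problem.
-/

noncomputable section

set_option linter.dupNamespace false

namespace Summit.NavierStokesRegularity.NavierStokesRegularity.Theorems

open MeasureTheory
open scoped ENNReal
open Literature.Analysis.FluidPDE

/-- **Item stmt-NavierStokesRegularity-15604** (`SlicedKelvin.FluxVelocityBound`), with the
constant `C = 12/π`: by the landed `FluxZoom.Registered` stubs `stub_nearFieldFlux`,
`stub_unitScaleVelocity`, `stub_fluxVelocity`. [this file] -/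
theorem slicedKelvin_fluxVelocityBound_proof :
    Summit.NavierStokesRegularity.NavierStokesRegularity.Theses.SlicedKelvin.FluxVelocityBound := by
  unfold Summit.NavierStokesRegularity.NavierStokesRegularity.Theses.SlicedKelvin.FluxVelocityBound
  refine ⟨12 / Real.pi, fun u hu hdec hdiv W Φ hW hΦ hcurl hflux x => ?_⟩
  have hL2 : (∫⁻ y, ‖u y‖ₑ ^ 2) < ⊤ := by
    have h := hdec.lintegral_enorm_iteratedFDeriv_sq_lt_top (μ := volume) 0
    have heq : (fun y => ‖iteratedFDeriv ℝ 0 u y‖ₑ ^ 2) = fun y => ‖u y‖ₑ ^ 2 := by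
      funext y
      rw [← ofReal_norm, ← ofReal_norm, norm_iteratedFDeriv_zero]
    rw [heq] at h
    exact h
  exact FluxZoom.Registered.stub_fluxVelocity
    (FluxZoom.Registered.stub_unitScaleVelocity FluxZoom.Registered.stub_nearFieldFlux)
    u (hu.of_le (by norm_cast)) hdiv hL2 W Φ hW hΦ hcurl hflux x

end Summit.NavierStokesRegularity.NavierStokesRegularity.Theorems

end
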